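import Summits.ABC.ABC.Theses.DefiniteXi
import Literature.NumberTheory.EllipticCurves.CongruenceNumber
import Literature.NumberTheory.EllipticCurves.CongruenceNumberLevelBoundExplicitProofs
import Literature.NumberTheory.EllipticCurves.PastenSpectralDegreeProofs
import Literature.NumberTheory.EllipticCurves.PastenCongruenceModulusProofs
import Literature.NumberTheory.EllipticCurves.SzpiroFreyConductorProofs
import HarnessLib

/-!
# STUB-IDEAS k2 · generation 5 — `stub_primeToSixDegreeBound` (P6), crux `DefiniteXi.SteinbergCore`
# (stmt-ABC-15024), line `p6_tamagawa_split`.  FAMILY 2 (reshape) — COMPLETION: T8, T9.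

Generations 2–4 of this seat ran T1–T7 (regime split 16 ∤ N; weaken-and-bootstrap via wild-locus
finiteness; spectral η-form — DEAD; slack glue; by-name recut to `FreyDegreeBound`; change of variable
N⁻ₘₐₓ / height; density-one) and every one landed on the summit or on a proved equivalence.  This file
types the two Family-2 techniques NOT yet run, each to its landing point:

* **T8 — strengthen-to-simplify into the DATA-FREE congruence currency.**  `CpsCongruenceBound`: the
  prime-to-6 part of the ARS congruence number `r_f` (`congruenceNumber`, a lattice index in
  `S₂(Γ₀(N); ℤ)` — no parametrisation datum, no minimality binder, no Manin constant) of the newform of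
  the Frey curve is `≪_ε N^{2+ε}`.  `stub_of_cpsCongruenceBound` (PROVED here modulo the two named
  inputs): Stub ⟸ CpsCongruenceBound + ARS Thm 2.1(a) `modularDegree_dvd_congruenceNumber` (named fact)
  + the optimal-quotient/Kenku transport `FreyCpsTransport` (print: Mazur 1978 + Kenku 1982, route item
  `MazurKenkuBound`/`MazurKenkuRadius` stmt-ABC-15193).  `cpsCongruenceBound_of_stub` (converse, M):
  by ARS Thm 2.1(b) `padicValNat_congruenceNumber_eq_of_not_sq_dvd` — for a Frey conductor `p ≥ 5 ⟹
  p² ∤ N` (`conductorNorm_freyCurve_dvd_holds`) — the two are EQUIVALENT modulo facts: the currency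
  change is honest but buys no weakness.  Unconditional rung in this currency, PROVED:
  `log_cps_congruenceNumber_le` (Murty–Pasten 2013 Thm 4.3, tree `MurtyPasten.log_congruenceNumber_le_holds`):
  `log cps(r_f) ≤ (1/5) N log N` — weaker than Stewart–Yu; the lattice-index method is capped there.
* **T9 — Northcott / finiteness reshaping.**  `P6ExceptionalFinite`: for every ε > 0 the set of coprime
  (a, b) whose minimal Frey parametrisation has `cps(deg) > N^{2+ε}` is finite.  `stub_of_exceptionalFinite`
  (S/M) and `exceptionalFinite_of_stub` (S/M, from bounded-conductor finiteness of Frey curves =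
  S-unit theorem) show it is EQUIVALENT to the stub: a socket for ineffective methods, none of which is
  uniform in the prime support (Ridout / subspace theorem fix S).

Sorries: only in helper bodies (`cpsCongruenceBound_of_stub`, `stub_of_exceptionalFinite`,
`exceptionalFinite_of_stub`).  `Stub` below is the registered stub statement verbatim.
-/

set_option linter.dupNamespace false
set_option autoImplicit false

namespace Summit.ABC.ABC.Cruxes.SteinbergCore.StubIdeas2G5

open Literature.NumberTheory.EllipticCurves
open Literature.NumberTheory.EllipticCurves.ModularForms
open CongruenceSubgroup

/-! ## The stub and the prime-to-six part -/

/-- Prime-to-`6` part `n / (2^{v₂(n)} 3^{v₃(n)})`, as it appears in the stub. -/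
def cps (n : ℕ) : ℕ := n / (ordProj[2] n * ordProj[3] n)

/-- The registered stub `P6TamagawaSplit.stub_primeToSixDegreeBound`, verbatim. -/
def Stub : Prop :=
  ∀ ε : ℝ, 0 < ε → ∃ C : ℝ, ∀ a b : ℤ, IsCoprime a b → a * b * (a + b) ≠ 0 →
    ∀ (N : ℕ) [NeZero N], (freyCurve a b).conductorNorm ℤ = N →
    ∀ D : ModularParametrizationData (freyCurve a b) N,
      (∀ D' : ModularParametrizationData (freyCurve a b) N, D.deg ≤ D'.deg) →
      ((D.deg / (ordProj[2] D.deg * ordProj[3] D.deg) : ℕ) : ℝ) ≤ C * (N : ℝ) ^ (2 + ε)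

theorem cps_eq (n : ℕ) : cps n = ordCompl[3] (ordCompl[2] n) := by
  unfold cps
  rw [← Nat.div_div_eq_div_mul, Nat.factorization_ordCompl, Finsupp.erase_ne (by decide)]

theorem cps_dvd_cps_of_dvd {d r : ℕ} (h : d ∣ r) : cps d ∣ cps r := by
  rw [cps_eq, cps_eq]
  exact Nat.ordCompl_dvd_ordCompl_of_dvd (Nat.ordCompl_dvd_ordCompl_of_dvd h 2) 3

theorem cps_pos {n : ℕ} (hn : n ≠ 0) : 0 < cps n := by
  rw [cps_eq]; exact Nat.ordCompl_pos 3 (Nat.ordCompl_pos 2 hn).ne'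

theorem cps_le_of_dvd {d r : ℕ} (h : d ∣ r) (hr : r ≠ 0) : cps d ≤ cps r :=
  Nat.le_of_dvd (cps_pos hr) (cps_dvd_cps_of_dvd h)

/-- `r_f ≠ 0` for the newform of a datum (Pasten–Shimura: `r_f ∣ ∏ η_f(P) > 0`; both inputs PROVED
in the tree). -/
theorem congruenceNumber_ne_zero_of_datum {W : WeierstrassCurve ℚ} {N : ℕ} [NeZero N]
    (D : ModularParametrizationData W N) : congruenceNumber D.f ≠ 0 := fun h0 =>
  (Nat.pos_iff_ne_zero.mp D.prod_heckeCongruenceModulus_pos)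
    (Nat.eq_zero_of_zero_dvd (h0 ▸ D.congruenceNumber_dvd_prod_heckeCongruenceModulus))

/-- Optimal data exist: among all data (of all elliptic `W'`) with the newform of `D`, one has least
degree — well-foundedness of `ℕ`, nothing else.  PROVED. -/
theorem exists_optimalDatum {W : WeierstrassCurve ℚ} [W.IsElliptic] {N : ℕ} [NeZero N]
    (D : ModularParametrizationData W N) :
    ∃ (W₀ : WeierstrassCurve ℚ) (_ : W₀.IsElliptic) (D₀ : ModularParametrizationData W₀ N),
      D₀.f = D.f ∧ ∀ (W' : WeierstrassCurve ℚ) [W'.IsElliptic] (D' : ModularParametrizationData W' N),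
        D'.f = D₀.f → D₀.modularDegree ≤ D'.modularDegree := by
  classical
  let S : Set ℕ := {m | ∃ (W' : WeierstrassCurve ℚ) (_ : W'.IsElliptic)
      (D' : ModularParametrizationData W' N), D'.f = D.f ∧ D'.modularDegree = m}
  have hne : S.Nonempty := ⟨D.modularDegree, W, ‹_›, D, rfl, rfl⟩
  obtain ⟨W₀, i₀, D₀, hf, hm⟩ := Nat.sInf_mem hne
  refine ⟨W₀, i₀, D₀, hf, fun W' _ D' hD' => ?_⟩
  rw [hm]
  exact Nat.sInf_le ⟨W', ‹_›, D', hD'.trans hf, rfl⟩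

/-! ## T8 — the data-free congruence currency -/

/-- **T8 currency.**  The prime-to-6 part of the congruence number of the newform of the Frey curve is
`≪_ε N^{2+ε}`.  Data-free: a statement about the lattice `S₂(Γ₀(N); ℤ)` and one `q`-expansion
(vacuous, like the stub, where no newform exists — modularity is the route binder `FreyModularity`). -/
def CpsCongruenceBound : Prop :=
  ∀ ε : ℝ, 0 < ε → ∃ C : ℝ, ∀ a b : ℤ, IsCoprime a b → a * b * (a + b) ≠ 0 →
    ∀ (N : ℕ) [NeZero N], (freyCurve a b).conductorNorm ℤ = N →
    ∀ f : CuspForm (Gamma0 N) 2, IsNewformOf (freyCurve a b) f →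
      ((cps (congruenceNumber f) : ℕ) : ℝ) ≤ C * (N : ℝ) ^ (2 + ε)

/-- **Transport hypothesis (KNOWN IN PRINT, formal debt M).**  A parametrisation of `E_{a,b}` of least
degree among those of the model `y² = x(x−a)(x+b)` factors through the optimal quotient followed by a
cyclic ℚ-isogeny (degree in Kenku's list, `≤ 163`) and a `2`-power rescaling of the Néron lattice (the
model is minimal away from `2`), so `cps(deg) ≤ 163 · cps(deg_optimal)`.  Sources: Mazur 1978 Thm 1,
Kenku 1982; Pasten–Shimura 2024 §3; route items `MazurKenkuBound`, `MazurKenkuRadius` (stmt-ABC-15193). -/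
def FreyCpsTransport : Prop :=
  ∀ a b : ℤ, IsCoprime a b → a * b * (a + b) ≠ 0 →
    ∀ (N : ℕ) [NeZero N], (freyCurve a b).conductorNorm ℤ = N →
    ∀ D : ModularParametrizationData (freyCurve a b) N,
      (∀ D' : ModularParametrizationData (freyCurve a b) N, D.deg ≤ D'.deg) →
      ∀ (W₀ : WeierstrassCurve ℚ) [W₀.IsElliptic] (D₀ : ModularParametrizationData W₀ N), D₀.f = D.f →
        (∀ (W' : WeierstrassCurve ℚ) [W'.IsElliptic] (D' : ModularParametrizationData W' N),
            D'.f = D₀.f → D₀.modularDegree ≤ D'.modularDegree) →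
        cps D.deg ≤ 163 * cps D₀.modularDegree

/-- The same transport read downwards (`deg_optimal ∣ deg` up to the `2`-power rescaling): `cps(deg_optimal)
≤ cps(deg)`.  KNOWN IN PRINT (optimal quotient universal property), formal debt M. -/
def FreyCpsTransportRev : Prop :=
  ∀ a b : ℤ, IsCoprime a b → a * b * (a + b) ≠ 0 →
    ∀ (N : ℕ) [NeZero N], (freyCurve a b).conductorNorm ℤ = N →
    ∀ D : ModularParametrizationData (freyCurve a b) N,
      (∀ D' : ModularParametrizationData (freyCurve a b) N, D.deg ≤ D'.deg) →
      ∀ (W₀ : WeierstrassCurve ℚ) [W₀.IsElliptic] (D₀ : ModularParametrizationData W₀ N), D₀.f = D.f →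
        (∀ (W' : WeierstrassCurve ℚ) [W'.IsElliptic] (D' : ModularParametrizationData W' N),
            D'.f = D₀.f → D₀.modularDegree ≤ D'.modularDegree) →
        cps D₀.modularDegree ≤ cps D.deg

/-- **H8a (S, PROVED modulo the two named inputs).**  Stub ⟸ data-free congruence bound. -/
theorem stub_of_cpsCongruenceBound (hR : modularDegree_dvd_congruenceNumber)
    (hT : FreyCpsTransport) (h : CpsCongruenceBound) : Stub := by
  intro ε hε
  obtain ⟨C, hC⟩ := h ε hε
  refine ⟨163 * C, ?_⟩
  intro a b hab h0 N _ hN D hmin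
  haveI := isElliptic_freyCurve h0
  obtain ⟨W₀, i₀, D₀, hf, hopt⟩ := exists_optimalDatum D
  have h1 : cps D.deg ≤ 163 * cps D₀.modularDegree := hT a b hab h0 N hN D hmin W₀ D₀ hf hopt
  have h2 : D₀.modularDegree ∣ congruenceNumber D₀.f := hR W₀ N D₀ hopt
  have h3 : cps D₀.modularDegree ≤ cps (congruenceNumber D.f) :=
    hf ▸ cps_le_of_dvd h2 (congruenceNumber_ne_zero_of_datum D₀)
  have h4 : ((cps (congruenceNumber D.f) : ℕ) : ℝ) ≤ C * (N : ℝ) ^ (2 + ε) :=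
    hC a b hab h0 N hN D.f D.isNewformOf
  show ((cps D.deg : ℕ) : ℝ) ≤ 163 * C * (N : ℝ) ^ (2 + ε)
  have h13 : ((cps D.deg : ℕ) : ℝ) ≤ 163 * ((cps (congruenceNumber D.f) : ℕ) : ℝ) := by
    exact_mod_cast h1.trans (Nat.mul_le_mul_left 163 h3)
  nlinarith [h13, h4]

/-- **H8b (M, converse — calibration).**  Stub ⟹ data-free congruence bound, by ARS Thm 2.1(b)
(`ord_p r_f = ord_p m_E` for `p² ∤ N`; every `p ≥ 5` has `p² ∤ N_{a,b}` since `N ∣ 2⁸ rad`), modularity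
(a datum exists, hence an `E`-minimal one by well-foundedness) and the downward transport.  Needs the
arithmetic helper "two nonzero naturals with equal `ord_p` for all `p ≥ 5` have equal `cps`". -/
theorem cpsCongruenceBound_of_stub (hARS : padicValNat_congruenceNumber_eq_of_not_sq_dvd)
    (hmod : Summit.ABC.ABC.Theses.DefiniteXi.FreyModularity)
    (hN : ∀ a b : ℤ, conductorNorm_freyCurve_dvd a b)
    (hT : FreyCpsTransportRev) (h : Stub) : CpsCongruenceBound := by
  sorry

/-- `hN` of H8b is PROVED in the tree. -/
example : ∀ a b : ℤ, conductorNorm_freyCurve_dvd a b := fun a b => conductorNorm_freyCurve_dvd_holds a b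

/-- **H8c — the unconditional rung in the T8 currency (PROVED).**  Murty–Pasten 2013 Thm 4.3 via the
tree theorem `MurtyPasten.log_congruenceNumber_le_holds`: `log cps(r_f) ≤ log r_f ≤ (1/5) N log N`.
This is the ceiling of the lattice-index method (`r_f ∣ i_N`), exponential in `N` — weaker than the
transcendence rung `exp(C N^{1/3} log³ N)` (Stewart–Yu); the polynomial `N^{2+ε}` is the summit. -/
theorem log_cps_congruenceNumber_le {W : WeierstrassCurve ℚ} [W.IsElliptic] {N : ℕ} [NeZero N]
    (D : ModularParametrizationData W N) :
    Real.log (cps (congruenceNumber D.f)) ≤ (1 / 5 : ℝ) * N * Real.log N := by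
  have hMP := MurtyPasten.log_congruenceNumber_le_holds W N D
  have hc0 : (0 : ℝ) < cps (congruenceNumber D.f) := by
    exact_mod_cast cps_pos (congruenceNumber_ne_zero_of_datum D)
  have hle : ((cps (congruenceNumber D.f) : ℕ) : ℝ) ≤ congruenceNumber D.f := by
    exact_mod_cast Nat.div_le_self _ _
  exact (Real.log_le_log hc0 hle).trans hMP

/-! ## T9 — Northcott / finiteness reshaping -/

/-- The `ε`-exceptional set of P6: coprime `(a, b)` whose `E`-minimal parametrisation has prime-to-6
degree `> N^{2+ε}` (constant `1`). -/
def P6Exceptional (ε : ℝ) : Set (ℤ × ℤ) :=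
  {x | IsCoprime x.1 x.2 ∧ x.1 * x.2 * (x.1 + x.2) ≠ 0 ∧
    ∃ (N : ℕ) (_ : NeZero N), (freyCurve x.1 x.2).conductorNorm ℤ = N ∧
      ∃ D : ModularParametrizationData (freyCurve x.1 x.2) N,
        (∀ D' : ModularParametrizationData (freyCurve x.1 x.2) N, D.deg ≤ D'.deg) ∧
        (N : ℝ) ^ (2 + ε) < ((cps D.deg : ℕ) : ℝ)}

/-- **T9 form of the stub.**  Every exceptional set is finite. -/
def P6ExceptionalFinite : Prop := ∀ ε : ℝ, 0 < ε → (P6Exceptional ε).Finite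

/-- Bounded-conductor finiteness of Frey curves (KNOWN: `rad(ab(a+b)) ∣ 2N`
(`radical_natAbs_dvd_two_mul_conductorNorm_freyCurve`, PROVED) + S-unit finiteness — Mahler 1933;
effective form `stewart_yu` in the tree, conditional on `yu`).  Formal debt M. -/
def FreyBoundedConductorFinite : Prop :=
  ∀ B : ℕ, {x : ℤ × ℤ | IsCoprime x.1 x.2 ∧ x.1 * x.2 * (x.1 + x.2) ≠ 0 ∧
    (freyCurve x.1 x.2).conductorNorm ℤ ≤ B}.Finite

/-- **H9a (S/M).**  Finiteness of every exceptional set gives the stub: `C := 1 + Σ_{(a,b) exceptional}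
cps(deg_min(a,b))` (all `E`-minimal data of a fixed `(a,b)` share one degree; `N` is the conductor). -/
theorem stub_of_exceptionalFinite (h : P6ExceptionalFinite) : Stub := by
  sorry

/-- **H9b (S/M).**  The stub gives finiteness: apply it with `ε/2`; an `ε`-exceptional pair then has
`N^{ε/2} < C`, so bounded conductor, so lies in a finite set. -/
theorem exceptionalFinite_of_stub (hfin : FreyBoundedConductorFinite) (h : Stub) :
    P6ExceptionalFinite := by
  sorry

end Summit.ABC.ABC.Cruxes.SteinbergCore.StubIdeas2G5
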